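import Literature.Probability.Percolation.FiveArmInnerExplore
import Literature.Probability.Percolation.FiveArmEUpper
import HarnessLib

/-!
# The interface walk from the black landing of plain five arms: confinement and chains (inner colour switching, II)

Topic `Literature/Probability/Percolation`; family `crit-perc`. PROOFS (and the explored colouring, a
definition; no named fact). The configuration-specific layer of the colour exchange for five plain
arms started on `∂Λ_m` (P. Nolin, *Near-critical percolation in two dimensions*, EJP 13 (2008), §5.1
Prop. 20 [arXiv 0711.4948: Prop. 19]; Bollobás–Riordan, *Percolation* (2006), Ch. 7, Claims 8–9),
for a landing tuple `s = (rp m i₀, …, rp m i₄)` in anticlockwise order with colours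
`κ = (B, W, W, W, ·)` and the core `Λ_m ∖ {s_j}` white (`FiveArmPlainArms.lean`):

the colouring `col` (grey on `{|·| < m}` and on `{|·| ≥ n}`, the white ring sites of the core and
the closed sites `some true`, the open sites `some false` — so that the bond `(s₀, s₀⁺)` is the exit
side of its inward face), the walk of `FiveArmInnerExplore.lean` from that bond, and, entirely by the
rim separation of `RimSeparation.lean` (no further topology): **the walk never examines the arms of
`s₂, s₃, s₄`** (the arm of `s₂` is fenced by the white arms of `s₁, s₃`; those of `s₃, s₄` and every
ring site of `(s₂, s₀)` are fenced from `s₀⁺` by the black arm of `s₀` and the arm of `s₂`), **it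
ends beyond the radius `n - 1`** (an inner end would put the white chain from `s₀⁺` at `s₀⁻` or next
to `s₄`), so that the black chain from `s₀` and the white chain from `s₀⁺` reach `∂Λ_{n-1}`, and the
white examined ring sites lie in `(s₀, s₂)` (`walk_package`).

## References

* P. Nolin, Near-critical percolation in two dimensions, *Electron. J. Probab.* 13 (2008), §5.1
  Prop. 20 (arXiv 0711.4948: Prop. 19) [Nolin2008].
* B. Bollobás, O. Riordan, *Percolation*, CUP (2006), Ch. 7 §7.2.3, Claims 8–9, pp. 174–175
  [BollobasRiordan2006].

## Mathlib / tree

Tree: `InnerExplore.Setting` and its API (`FiveArmInnerExplore.lean`); `rim_separation`,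
`eq_rp_of_adj_rp` (`RimSeparation.lean`); `Gadget.GadgetIdx`, `Gadget.sOf` (`FiveArmCoreGadget.lean`);
`plainArms`, `paint`, `coreOf` (`FiveArmPlainArms.lean`); `rp`, `rp_add_period`, `rp_ne_rp_of_lt`,
`exists_eq_rp`, `triNorm_rp` (`RingArcs.lean`); `PathIn` API (`SitePaths.lean`).
-/

noncomputable section

namespace Literature.Probability.Percolation

open LatticeModels SiteIface InnerExplore Gadget

namespace InnerWalk

variable (m n : ℕ) (i : Fin 5 → ℕ)

/-- **The ring sites of the core**: norm `m`, not a landing site. [folklore] -/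
def coreRing : Set (Site 2) := {v | triNorm v = m ∧ ∀ j, v ≠ sOf m i j}

open Classical in
/-- **The explored colouring** (first walk): grey on the open core and from the radius `n` on, the
core ring sites and the closed sites `some true`, the open sites `some false`. [cite: Nolin2008, §5.1 Prop. 20 (arXiv 0711.4948: Prop. 19)] -/
def col (ω : SiteConfig (Site 2)) : Site 2 → Option Bool := fun v =>
  if triNorm v < m ∨ (n : ℤ) ≤ triNorm v then none
  else if v ∈ coreRing m i then some true
  else if v ∈ ω then some false else some true

variable {m n i}

/-- The colouring is grey exactly off `{m ≤ |·| < n}`. [folklore] -/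
theorem col_eq_none_iff {ω : SiteConfig (Site 2)} {v : Site 2} :
    col m n i ω v = none ↔ triNorm v < m ∨ (n : ℤ) ≤ triNorm v := by
  unfold col
  split_ifs with h <;> simp [h]

/-- The `some false` sites: coloured, off the core ring, open. [folklore] -/
theorem col_eq_some_false_iff {ω : SiteConfig (Site 2)} {v : Site 2} :
    col m n i ω v = some false ↔ ((m : ℤ) ≤ triNorm v ∧ triNorm v < n) ∧ v ∉ coreRing m i ∧ v ∈ ω := by
  unfold col
  split_ifs with h1 h2 h3
  · exact ⟨fun h => absurd h (by simp), fun h => by omega⟩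
  · exact ⟨fun h => absurd h (by simp), fun h => (h.2.1 h2).elim⟩
  · exact ⟨fun _ => ⟨by omega, h2, h3⟩, fun _ => rfl⟩
  · exact ⟨fun h => absurd h (by simp), fun h => (h3 h.2.2).elim⟩

/-- The `some true` sites: coloured, and on the core ring or closed. [folklore] -/
theorem col_eq_some_true_iff {ω : SiteConfig (Site 2)} {v : Site 2} :
    col m n i ω v = some true ↔ ((m : ℤ) ≤ triNorm v ∧ triNorm v < n) ∧ (v ∈ coreRing m i ∨ v ∉ ω) := by
  unfold col
  split_ifs with h1 h2 h3
  · exact ⟨fun h => absurd h (by simp), fun h => by omega⟩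
  · exact ⟨fun _ => ⟨by omega, Or.inl h2⟩, fun _ => rfl⟩
  · exact ⟨fun h => absurd h (by simp), fun h => (h.2.elim h2 fun h' => h' h3).elim⟩
  · exact ⟨fun _ => ⟨by omega, Or.inr h3⟩, fun _ => rfl⟩

/-- Indices normalised into a window of one period. [folklore] -/
theorem exists_idx_window {m : ℕ} (hk : 1 ≤ m) (a k₀ : ℕ) : ∃ k, a ≤ k ∧ k < a + 6 * m ∧ rp m k = rp m k₀ := by
  set P := 6 * m with hP
  have hP0 : 0 < P := by omega
  have hmod : rp m (k₀ % P) = rp m k₀ := by unfold rp; rw [← hP, Nat.mod_mod]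
  have hdiv : P * (a / P) ≤ a := Nat.mul_div_le a P
  have hlt : a < P * (a / P) + P := by
    have := Nat.div_add_mod a P; have := Nat.mod_lt a hP0; omega
  have hk₀ : k₀ % P < P := Nat.mod_lt _ hP0
  by_cases hcase : a ≤ k₀ % P + P * (a / P)
  · refine ⟨k₀ % P + P * (a / P), hcase, by omega, ?_⟩
    rw [show P * (a / P) = (a / P) * (6 * m) by rw [hP]; ring, rp_add_mul_period, hmod]
  · refine ⟨k₀ % P + P * (a / P) + P, by omega, by omega, ?_⟩
    rw [show k₀ % P + P * (a / P) + P = k₀ % P + (a / P + 1) * (6 * m) by rw [hP]; ring, rp_add_mul_period, hmod]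

/-- **The single-walk package.** For landing indices `GadgetIdx m i`, `m + 2 ≤ n`, colours
`κ₀ = B`, `κ₁ = κ₂ = κ₃ = W`, plain arms `(y, w)` of `ω` from the landing tuple with the core white,
let `c = col m n i ω`, `F₀` the inward face of the bond `(s₀, s₀⁺)`, `X` the set of sites traversed by
the interface walk from `F₀`. Then: (1) the arms of `s₂, s₃, s₄` are not traversed; (2) the black
(`some false`) chain from `s₀` and the white (`some true`) chain from `s₀⁺` through traversed sites
reach `∂Λ_{n-1}`; (3) the only traversed `some false` ring site is `s₀`, and every traversed
`some true` ring site is `rp m k` with `i₀ < k < i₂`; (4) every traversed site is chained, in its colour, to the corresponding end of the bond. [cite: Nolin2008, §5.1 Prop. 20 (arXiv 0711.4948: Prop. 19)] -/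
theorem walk_package (h : GadgetIdx m i) (hmn : m + 2 ≤ n) {κ : Fin 5 → Bool} (hκ0 : κ 0 = true) (hκ1 : κ 1 = false)
    (hκ2 : κ 2 = false) (hκ3 : κ 3 = false) {ω : SiteConfig (Site 2)} {y : Fin 5 → Site 2}
    (w : ∀ j, triGraph.Walk (sOf m i j) (y j))
    (hw : ∀ j, y j ∈ triSphere n ∧ (w j).IsPath ∧ (∀ v ∈ (w j).support, v = sOf m i j ∨ ((m : ℤ) < triNorm v ∧ triNorm v ≤ n)) ∧
      IsColouredPath ω (κ j) (w j))
    (hdisj : Pairwise fun a b => Disjoint (w a).support.toFinset (w b).support.toFinset)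
    (hpaint : ω ∈ paint (coreOf (sOf m i) m) ∅) :
    (∀ j, j ≠ 0 → j ≠ 1 → ∀ z ∈ (w j).support,
      z ∉ traversed (col m n i ω) (inFace m (i 0)) (len (col m n i ω) (inFace m (i 0)))) ∧
    (∃ q, triNorm q = (n : ℤ) - 1 ∧ PathIn triGraph {x | col m n i ω x = some false ∧
      x ∈ traversed (col m n i ω) (inFace m (i 0)) (len (col m n i ω) (inFace m (i 0)))} (rp m (i 0)) q) ∧
    (∃ p, triNorm p = (n : ℤ) - 1 ∧ PathIn triGraph {x | col m n i ω x = some true ∧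
      x ∈ traversed (col m n i ω) (inFace m (i 0)) (len (col m n i ω) (inFace m (i 0)))} (rp m (i 0 + 1)) p) ∧
    (∀ x ∈ traversed (col m n i ω) (inFace m (i 0)) (len (col m n i ω) (inFace m (i 0))),
      col m n i ω x = some false → triNorm x = m → x = rp m (i 0)) ∧
    (∀ x ∈ traversed (col m n i ω) (inFace m (i 0)) (len (col m n i ω) (inFace m (i 0))),
      col m n i ω x = some true → triNorm x = m → ∃ k, i 0 < k ∧ k < i 2 ∧ x = rp m k) ∧
    (∀ x ∈ traversed (col m n i ω) (inFace m (i 0)) (len (col m n i ω) (inFace m (i 0))),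
      col m n i ω x = some true → PathIn triGraph {x | col m n i ω x = some true ∧
        x ∈ traversed (col m n i ω) (inFace m (i 0)) (len (col m n i ω) (inFace m (i 0)))} (rp m (i 0 + 1)) x) ∧
    (∀ x ∈ traversed (col m n i ω) (inFace m (i 0)) (len (col m n i ω) (inFace m (i 0))),
      col m n i ω x = some false → PathIn triGraph {x | col m n i ω x = some false ∧
        x ∈ traversed (col m n i ω) (inFace m (i 0)) (len (col m n i ω) (inFace m (i 0)))} (rp m (i 0)) x) ∧
    (∀ x ∈ traversed (col m n i ω) (inFace m (i 0)) (len (col m n i ω) (inFace m (i 0))), col m n i ω x ≠ none) := by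
  classical
  have hm := h.four_le; have hbase := h.base
  have h01 := h.lt01; have h12 := h.lt12; have h23 := h.lt23; have h34 := h.lt34; have h40 := h.lt40
  have hk : 1 ≤ m := by omega
  have nrp : ∀ j, triNorm (rp m j) = m := fun j => triNorm_rp hk j
  have hsOf : ∀ j, sOf m i j = rp m (i j) := fun j => rfl
  -- arms
  have hyn : ∀ j, triNorm (y j) = n := fun j => mem_triSphere_iff.1 (hw j).1
  have hsupp : ∀ j, ∀ v ∈ (w j).support, v = rp m (i j) ∨ ((m : ℤ) < triNorm v ∧ triNorm v ≤ n) := fun j => (hw j).2.2.1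
  have hcolw : ∀ j, ∀ v ∈ (w j).support, (v ∈ ω ↔ κ j = true) := fun j => (hw j).2.2.2
  have hstart : ∀ j, rp m (i j) ∈ (w j).support := fun j => (w j).start_mem_support
  have hdj : ∀ {a b : Fin 5}, a ≠ b → ∀ v, v ∈ (w a).support → v ∉ (w b).support := fun hab v hv hv' =>
    Finset.disjoint_left.1 (hdisj hab) (List.mem_toFinset.2 hv) (List.mem_toFinset.2 hv')
  have hnormw : ∀ j, ∀ v ∈ (w j).support, (m : ℤ) ≤ triNorm v ∧ triNorm v ≤ n := fun j v hv => by
    rcases hsupp j v hv with rfl | h'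
    · rw [nrp]; omega
    · omega
  -- landing sites: index identification
  have hib : ∀ j, i 0 ≤ i j ∧ i j < i 0 + 6 * m := h.i_bounds
  have eq_idx : ∀ {k : ℕ} {j : Fin 5}, i 0 ≤ k → k < i 0 + 6 * m → rp m k = rp m (i j) → k = i j := by
    intro k j hk1 hk2 e
    by_contra hne
    rcases lt_or_gt_of_ne hne with hlt | hgt
    · exact rp_ne_rp_of_lt hk hlt (by have := hib j; omega) e
    · exact rp_ne_rp_of_lt hk hgt (by have := hib j; omega) e.symm
  -- core sites are white
  have hcoreW : ∀ v, v ∈ coreRing m i → v ∉ ω := by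
    rintro v ⟨hv, hvs⟩ hvω
    have hmem : v ∈ coreOf (sOf m i) m := by
      rw [coreOf, Finset.mem_sdiff, mem_triBall_iff]
      refine ⟨by rw [hv], fun hh => ?_⟩
      obtain ⟨j, -, hj⟩ := Finset.mem_image.1 hh
      exact hvs j hj.symm
    exact (hpaint v hmem).1 hvω
  -- ring sites: landings or core ring
  have ring_cases : ∀ v, triNorm v = m → v ∈ coreRing m i ∨ ∃ j, v = rp m (i j) := by
    intro v hv
    by_cases hh : ∃ j, v = rp m (i j)
    · exact Or.inr hh
    · push Not at hh
      exact Or.inl ⟨hv, hh⟩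
  -- the setting
  have c_start : col m n i ω (rp m (i 0)) = some false := by
    rw [col_eq_some_false_iff]
    refine ⟨⟨by rw [nrp], by rw [nrp]; omega⟩, fun ⟨_, hh⟩ => hh 0 rfl, (hcolw 0 _ (hstart 0)).2 hκ0⟩
  have c_next : col m n i ω (rp m (i 0 + 1)) = some true := by
    rw [col_eq_some_true_iff]
    refine ⟨⟨by rw [nrp], by rw [nrp]; omega⟩, ?_⟩
    rcases ring_cases _ (nrp (i 0 + 1)) with hc | ⟨j, hj⟩
    · exact Or.inl hc
    · right
      have hij : i 0 + 1 = i j := eq_idx (by omega) (by omega) hj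
      have hib' := hib j
      have hκj : κ j = false := by
        fin_cases j <;> simp at hij hib' ⊢ <;> omega
      rw [hj]
      exact fun hω => by have := (hcolw j _ (hstart j)).1 hω; rw [hκj] at this; exact Bool.false_ne_true this
  let E : Setting :=
    { m := m, n := n, c := col m n i ω, j₀ := i 0, hm := by omega, hmn := hmn,
      grey_in := fun v hv => col_eq_none_iff.2 (Or.inl hv),
      grey_out := fun v hv => col_eq_none_iff.2 (Or.inr hv),
      col := fun v h1 h2 hn => by rw [col_eq_none_iff] at hn; omega,
      c_start := c_start, c_next := c_next }
  -- abbreviations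
  set c := col m n i ω with hc
  set X : Set (Site 2) := traversed c (inFace m (i 0)) (len c (inFace m (i 0))) with hX
  have hEc : E.c = c := rfl
  have hEX : traversed E.c E.F₀ E.T = X := rfl
  -- colour facts
  have cfalse : ∀ {x}, c x = some false → x ∈ ω ∧ x ∉ coreRing m i ∧ (m : ℤ) ≤ triNorm x ∧ triNorm x < n := fun hx => by
    obtain ⟨⟨h1, h2⟩, h3, h4⟩ := col_eq_some_false_iff.1 hx; exact ⟨h4, h3, h1, h2⟩
  have ctrue : ∀ {x}, c x = some true → x ∉ ω ∧ (m : ℤ) ≤ triNorm x ∧ triNorm x < n := fun hx => by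
    obtain ⟨⟨h1, h2⟩, h3⟩ := col_eq_some_true_iff.1 hx
    exact ⟨h3.elim (hcoreW _) id, h1, h2⟩
  have cX : ∀ {x}, x ∈ X → c x ≠ none := fun hx => ne_none_of_traversed E.hfin le_rfl hx
  -- arm colours versus `c`
  have armB : ∀ v ∈ (w 0).support, c v ≠ some true := fun v hv h' => (ctrue h').1 ((hcolw 0 v hv).2 hκ0)
  have armW : ∀ j, κ j = false → ∀ v ∈ (w j).support, c v ≠ some false := fun j hj v hv h' => by
    have := (hcolw j v hv).1 (cfalse h').1; rw [hj] at this; exact Bool.false_ne_true this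
  -- sub-arms: from a site of an arm back to its landing site
  have subarm : ∀ j, ∀ z ∈ (w j).support, PathIn triGraph {v | v ∈ (w j).support} z (rp m (i j)) := fun j z hz =>
    (PathIn.of_walk ((w j).takeUntil z hz) fun v hv => (w j).support_takeUntil_subset_support hz hv).symm
  -- the two separations
  have sep13 : ∀ S : Set (Site 2), (∀ z ∈ S, (m : ℤ) ≤ triNorm z ∧ triNorm z ≤ n ∧ z ∉ (w 1).support ∧ z ∉ (w 3).support) →
      ¬ PathIn triGraph S (rp m (i 2)) (rp m (i 0 + 6 * m)) := fun S hS =>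
    rim_separation (jA := i 1) (jB := i 3) (by omega) (by omega) (by omega) (w 1) (w 3) (hsupp 1) (hsupp 3) (hw 1).2.1 (hw 3).2.1
      (hyn 1) (hyn 3) h12 h23 (by omega) (by omega) hS
  have sep02 : ∀ j', i 2 < j' → j' < i 0 + 6 * m → ∀ S : Set (Site 2),
      (∀ z ∈ S, (m : ℤ) ≤ triNorm z ∧ triNorm z ≤ n ∧ z ∉ (w 0).support ∧ z ∉ (w 2).support) →
      ¬ PathIn triGraph S (rp m (i 0 + 1)) (rp m j') := fun j' hj1 hj2 S hS =>
    rim_separation (jA := i 0) (jB := i 2) (by omega) (by omega) (by omega) (w 0) (w 2) (hsupp 0) (hsupp 2) (hw 0).2.1 (hw 2).2.1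
      (hyn 0) (hyn 2) (by omega) (by omega) hj1 hj2 hS
  -- (1a) the arm of `s₂` is not traversed
  have L2 : ∀ z ∈ (w 2).support, z ∉ X := by
    intro z hz hzX
    have hcz : c z = some true := by
      rcases Option.ne_none_iff_exists'.1 (cX hzX) with ⟨b, hb⟩
      cases b
      · exact absurd hb (armW 2 hκ2 z hz)
      · exact hb
    obtain ⟨-, z', hzz', hcz', hF⟩ := E.traversed_true hzX hcz
    refine sep13 ({x | c x = some false ∧ x ∈ X} ∪ {v | v ∈ (w 2).support}) ?_ ?_
    · rintro v (⟨hv, -⟩ | hv)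
      · obtain ⟨hvω, -, h1, h2⟩ := cfalse hv
        exact ⟨h1, by omega, fun h' => armW 1 hκ1 v h' hv, fun h' => armW 3 hκ3 v h' hv⟩
      · obtain ⟨h1, h2⟩ := hnormw 2 v hv
        exact ⟨h1, h2, fun h' => hdj (by decide) v hv h', fun h' => hdj (by decide) v hv h'⟩
    · rw [rp_add_period]
      exact (((hF.mono Set.subset_union_left).tail hzz'.symm (Or.inr hz)).trans ((subarm 2 z hz).mono Set.subset_union_right)).symm
  -- white chains from `s₀⁺` extended along an arm, fenced by the arms of `s₀` and `s₂`
  have fence : ∀ j, j ≠ 0 → j ≠ 2 → ∀ z ∈ (w j).support, ∀ z', (z' = z ∨ triGraph.Adj z' z) →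
      PathIn triGraph {x | c x = some true ∧ x ∈ X} (rp m (i 0 + 1)) z' → ∀ j', j' = i j → i 2 < j' → j' < i 0 + 6 * m → False := by
    intro j hj0 hj2 z hz z' hzz' hP j' hj' hj1 hj2'
    refine sep02 j' hj1 hj2' ({x | c x = some true ∧ x ∈ X} ∪ {v | v ∈ (w j).support}) ?_ ?_
    · rintro v (⟨hv, hvX⟩ | hv)
      · obtain ⟨-, h1, h2⟩ := ctrue hv
        exact ⟨h1, by omega, fun h' => armB v h' hv, fun h' => L2 v h' hvX⟩
      · obtain ⟨h1, h2⟩ := hnormw j v hv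
        exact ⟨h1, h2, fun h' => hdj hj0 v hv h', fun h' => hdj hj2 v hv h'⟩
    · rw [hj']
      have h2 : PathIn triGraph ({x | c x = some true ∧ x ∈ X} ∪ {v | v ∈ (w j).support}) z' z := by
        rcases hzz' with rfl | hadj
        · exact PathIn.refl (Or.inr hz)
        · exact PathIn.of_adj (hP.mono Set.subset_union_left).right_mem (Or.inr hz) hadj
      exact ((hP.mono Set.subset_union_left).trans h2).trans ((subarm j z hz).mono Set.subset_union_right)
  -- (1b) the arms of `s₃`, `s₄` are not traversed
  have L34 : ∀ j, j ≠ 0 → j ≠ 1 → j ≠ 2 → ∀ z ∈ (w j).support, z ∉ X := by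
    intro j hj0 hj1 hj2 z hz hzX
    have hidx : i 2 < i j ∧ i j < i 0 + 6 * m := by
      have hj34 : j = 3 ∨ j = 4 := by fin_cases j <;> simp at hj0 hj1 hj2 ⊢
      rcases hj34 with rfl | rfl <;> constructor <;> omega
    rcases Option.ne_none_iff_exists'.1 (cX hzX) with ⟨b, hb⟩
    cases b
    · obtain ⟨-, z', hzz', hcz', hT⟩ := E.traversed_false hzX hb
      exact fence j hj0 hj2 z hz z' (Or.inr hzz'.symm) hT _ rfl hidx.1 hidx.2
    · exact fence j hj0 hj2 z hz z (Or.inl rfl) (E.traversed_true hzX hb).1 _ rfl hidx.1 hidx.2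
  have P1 : ∀ j, j ≠ 0 → j ≠ 1 → ∀ z ∈ (w j).support, z ∉ X := by
    intro j hj0 hj1
    by_cases hj2 : j = 2
    · subst hj2; exact L2
    · exact L34 j hj0 hj1 hj2
  -- (2) the end of the walk is beyond the radius `n - 1`
  obtain ⟨jT, hE, hg, hT, hF, a1, a2, a3, hcase⟩ := E.terminal
  have outer : (n : ℤ) ≤ triNorm (faceVertex (walk c E.F₀ E.T) jT) ∧
      triNorm (faceVertex (walk c E.F₀ E.T) (jT + 1)) = n - 1 ∧ triNorm (faceVertex (walk c E.F₀ E.T) (jT + 2)) = n - 1 := by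
    rcases hcase with hc' | ⟨hgm, hpm, hqm⟩
    · exact hc'
    exfalso
    set p := faceVertex (walk c E.F₀ E.T) (jT + 1) with hp
    set q := faceVertex (walk c E.F₀ E.T) (jT + 2) with hq
    have hcq : c q = some false := hE.2
    have hcp : c p = some true := hE.1
    obtain ⟨hqω, hqcore, -, -⟩ := cfalse hcq
    -- `q` is a black landing site
    obtain ⟨l, hl⟩ : ∃ l, q = rp m (i l) := by
      rcases ring_cases q hqm with hc' | hh
      · exact absurd hc' hqcore
      · exact hh
    have hκl : κ l = true := (hcolw l _ (hl ▸ hstart l)).1 hqω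
    have hl04 : l = 0 ∨ l = 4 := by
      fin_cases l
      · exact Or.inl rfl
      · exact absurd (hκ1.symm.trans hκl) Bool.false_ne_true
      · exact absurd (hκ2.symm.trans hκl) Bool.false_ne_true
      · exact absurd (hκ3.symm.trans hκl) Bool.false_ne_true
      · exact Or.inr rfl
    -- `p` is a ring neighbour of `q`
    have hpq : p = rp m (i l + 1) ∨ p = rp m (i l - 1) :=
      eq_rp_of_adj_rp hk (by have := hib l; omega) hpm (by rw [← hl]; exact a2.symm)
    rcases hl04 with rfl | rfl
    · rcases hpq with hp1 | hp1
      · exact E.terminal_ne_start hE hg hp1 hl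
      · refine sep02 (i 0 - 1 + 6 * m) (by omega) (by omega) {x | c x = some true ∧ x ∈ X} ?_ ?_
        · rintro v ⟨hv, hvX⟩
          obtain ⟨-, h1, h2⟩ := ctrue hv
          exact ⟨h1, by omega, fun h' => armB v h' hv, fun h' => L2 v h' hvX⟩
        · rw [rp_add_period, ← hp1]; exact hT
    · rcases hpq with hp1 | hp1
      · by_cases hwrap : i 4 + 1 = i 0 + 6 * m
        · rw [hwrap, rp_add_period] at hp1
          rw [hp1, c_start] at hcp
          exact absurd hcp (by simp)
        · refine sep02 (i 4 + 1) (by omega) (by omega) {x | c x = some true ∧ x ∈ X} ?_ (by rw [← hp1]; exact hT)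
          rintro v ⟨hv, hvX⟩
          obtain ⟨-, h1, h2⟩ := ctrue hv
          exact ⟨h1, by omega, fun h' => armB v h' hv, fun h' => L2 v h' hvX⟩
      · refine sep02 (i 4 - 1) (by omega) (by omega) {x | c x = some true ∧ x ∈ X} ?_ (by rw [← hp1]; exact hT)
        rintro v ⟨hv, hvX⟩
        obtain ⟨-, h1, h2⟩ := ctrue hv
        exact ⟨h1, by omega, fun h' => armB v h' hv, fun h' => L2 v h' hvX⟩
  obtain ⟨-, hpn, hqn⟩ := outer
  -- (3) the traversed ring sites
  have P6 : ∀ x ∈ X, c x = some false → triNorm x = m → x = rp m (i 0) := by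
    intro x hxX hcx hxm
    obtain ⟨hxω, hxcore, -, -⟩ := cfalse hcx
    obtain ⟨l, hl⟩ : ∃ l, x = rp m (i l) := by
      rcases ring_cases x hxm with hc' | hh
      · exact absurd hc' hxcore
      · exact hh
    have hκl : κ l = true := (hcolw l _ (hl ▸ hstart l)).1 hxω
    fin_cases l
    · exact hl
    · exact absurd (hκ1.symm.trans hκl) Bool.false_ne_true
    · exact absurd (hκ2.symm.trans hκl) Bool.false_ne_true
    · exact absurd (hκ3.symm.trans hκl) Bool.false_ne_true
    · exact absurd hxX (P1 4 (by decide) (by decide) x (hl ▸ hstart 4))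
  have P7 : ∀ x ∈ X, c x = some true → triNorm x = m → ∃ k, i 0 < k ∧ k < i 2 ∧ x = rp m k := by
    intro x hxX hcx hxm
    obtain ⟨k₀, -, hk₀⟩ := exists_eq_rp hk hxm
    obtain ⟨k, hk1, hk2, hkk⟩ := exists_idx_window hk (i 0) k₀
    rw [← hk₀] at hkk
    -- `k ≠ i₀` (that site is `some false`), `k ≠ i₂` (on the arm of `s₂`), and not beyond `i₂`
    rcases Nat.lt_or_ge k (i 2) with hlt | hge
    · refine ⟨k, lt_of_le_of_ne hk1 ?_, hlt, hkk.symm⟩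
      rintro rfl
      rw [← hkk, c_start] at hcx; exact absurd hcx (by simp)
    · exfalso
      rcases Nat.eq_or_lt_of_le hge with heq | hgt
      · exact P1 2 (by decide) (by decide) x (by rw [← hkk, ← heq]; exact hstart 2) hxX
      · refine sep02 k hgt hk2 {x | c x = some true ∧ x ∈ X} ?_ (by rw [hkk]; exact (E.traversed_true hxX hcx).1)
        rintro v ⟨hv, hvX⟩
        obtain ⟨-, h1, h2⟩ := ctrue hv
        exact ⟨h1, by omega, fun h' => armB v h' hv, fun h' => L2 v h' hvX⟩
  exact ⟨P1, ⟨_, hqn, hF⟩, ⟨_, hpn, hT⟩, P6, P7, fun x hx hcx => (E.traversed_true hx hcx).1, fun x hx hcx => (E.traversed_false hx hcx).1,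
    fun x hx => cX hx⟩

end InnerWalk

end Literature.Probability.Percolation

end
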